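import Mathlib
import Literature.Combinatorics.Additive.TripleProductProperty

/-!
# `SnSubsetDichotomy.ThresholdSubsetTriples`, line `triality-uniquely-cubing-translate` — thinned-coset packing
# (Negative-side helper of crux `stmt-MatrixMultiplication-10882`, lead a1-0; any group, any `g`)

Every optimum of the symmetric design searches (census c4 §5: n = 6, 9, 12) is a THINNED COSET: a set `S`
inside one right coset `Y·a` of an overgroup `Y` (there: Young subgroups with one 6-block, thinning
`θ = |Y|/|S| = 1, 10, 15`).  This file proves what such a position costs.  If `S ⊆ Y·a` and the pair
`(S, gS)` satisfies the two-set consequence of the triple product property (`s s′⁻¹·(g t)(g t′)⁻¹ = 1`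
only trivially — implied by the TPP of `(S, gS, g²S)` for non-empty `S`), then
`|S|²·|Y ∩ gYg⁻¹| ≤ |Y|²` (`stub_thinnedCosetPacking`), i.e. the thinning factor obeys
`θ² ≥ |Y ∩ gYg⁻¹|`.  Proof: `(s, t, z) ↦ (a s⁻¹·z, g⁻¹z⁻¹g·t a⁻¹)` maps `S × S × (Y ∩ gYg⁻¹)`
injectively into `Y × Y`, because `(first)·g·(second) = a·(s⁻¹ g t)·a⁻¹` and
`(s, t) ↦ s⁻¹ g t` is injective by the pair condition.  For a Young overgroup `Y = ∏ Sym(A_i)` of `S_n`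
the meet group `Y ∩ gYg⁻¹ = ∏_{i,j} Sym(A_i ∩ gA_j)` has order `∏ m_ij!`, so a symmetric witness thinned
out of a Young coset pays `√(∏ m_ij!)` — the count behind census c4 §5 (iv).
-/

set_option linter.dupNamespace false

namespace Summit.MatrixMultiplication.MatrixMultiplication.Theorems.ThresholdSubsetTriples

open Literature.Combinatorics.Additive

/-- The pair condition `s s′⁻¹ (g t)(g t′)⁻¹ = 1 ⇒ s = s′ ∧ t = t′` makes `(s, t) ↦ s⁻¹ g t` injective on
`S × S`. -/
theorem inv_mul_mul_injective_of_pair {G : Type*} [Group G] {S : Finset G} {g : G}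
    (hpair : ∀ s ∈ S, ∀ s' ∈ S, ∀ t ∈ S, ∀ t' ∈ S, s * s'⁻¹ * (g * t * (g * t')⁻¹) = 1 → s = s' ∧ t = t')
    {s t s₂ t₂ : G} (hs : s ∈ S) (ht : t ∈ S) (hs₂ : s₂ ∈ S) (ht₂ : t₂ ∈ S)
    (h : s⁻¹ * g * t = s₂⁻¹ * g * t₂) : s = s₂ ∧ t = t₂ := by
  have key := hpair s₂ hs₂ s hs t ht t₂ ht₂ (by
    calc s₂ * s⁻¹ * (g * t * (g * t₂)⁻¹) = s₂ * (s⁻¹ * g * t) * t₂⁻¹ * g⁻¹ := by group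
      _ = s₂ * (s₂⁻¹ * g * t₂) * t₂⁻¹ * g⁻¹ := by rw [h]
      _ = 1 := by group)
  exact ⟨key.1.symm, key.2⟩

/-- **Thinned-coset packing** (registered stub `stub_thinnedCosetPacking` of crux
`stmt-MatrixMultiplication-10882`): in any group, if a finite set `S` lies in the right coset `Y·a` of a
subgroup `Y` and the pair `(S, gS)` satisfies the two-set consequence of the triple product property, then
`|S|·|S|·|Y ∩ gYg⁻¹| ≤ |Y|·|Y|` — the thinning factor `θ = |Y|/|S|` is at least `√|Y ∩ gYg⁻¹|`. -/
theorem stub_thinnedCosetPacking {G : Type*} [Group G] [DecidableEq G] [Fintype G] (Y : Subgroup G)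
    [DecidablePred (· ∈ Y)] (a g : G) (S : Finset G) (hS : ∀ s ∈ S, s * a⁻¹ ∈ Y)
    (hpair : ∀ s ∈ S, ∀ s' ∈ S, ∀ t ∈ S, ∀ t' ∈ S, s * s'⁻¹ * (g * t * (g * t')⁻¹) = 1 → s = s' ∧ t = t') :
    S.card * S.card * (Finset.univ.filter fun z : G => z ∈ Y ∧ g⁻¹ * z * g ∈ Y).card ≤
      (Finset.univ.filter fun y : G => y ∈ Y).card * (Finset.univ.filter fun y : G => y ∈ Y).card := by
  classical
  set M : Finset G := Finset.univ.filter fun z : G => z ∈ Y ∧ g⁻¹ * z * g ∈ Y with hM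
  set FY : Finset G := Finset.univ.filter fun y : G => y ∈ Y with hFY
  -- the map Φ : S × S × M → FY × FY
  let Φ : G × G × G → G × G := fun p => (a * p.1⁻¹ * p.2.2, g⁻¹ * p.2.2⁻¹ * g * (p.2.1 * a⁻¹))
  have hmaps : ∀ p ∈ S ×ˢ (S ×ˢ M), Φ p ∈ FY ×ˢ FY := by
    rintro ⟨s, t, z⟩ hp
    simp only [Finset.mem_product] at hp
    obtain ⟨hs, ht, hz⟩ := hp
    rw [hM, Finset.mem_filter] at hz
    obtain ⟨-, hzY, hzg⟩ := hz
    simp only [Finset.mem_product, hFY, Finset.mem_filter, Finset.mem_univ, true_and, Φ]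
    constructor
    · -- a s⁻¹ z ∈ Y : (s a⁻¹)⁻¹ ∈ Y and z ∈ Y
      have h1 : a * s⁻¹ = (s * a⁻¹)⁻¹ := by group
      rw [h1]
      exact Y.mul_mem (Y.inv_mem (hS s hs)) hzY
    · -- g⁻¹ z⁻¹ g · (t a⁻¹) ∈ Y
      have h2 : g⁻¹ * z⁻¹ * g = (g⁻¹ * z * g)⁻¹ := by group
      rw [h2]
      exact Y.mul_mem (Y.inv_mem hzg) (hS t ht)
  have hinj : Set.InjOn Φ (S ×ˢ (S ×ˢ M) : Finset (G × G × G)) := by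
    rintro ⟨s, t, z⟩ hp ⟨s₂, t₂, z₂⟩ hp₂ heq
    simp only [Finset.coe_product, Set.mem_prod, Finset.mem_coe] at hp hp₂
    simp only [Φ, Prod.mk.injEq] at heq
    obtain ⟨h1, h2⟩ := heq
    -- products of the two coordinates agree: a (s⁻¹ g t) a⁻¹ = a (s₂⁻¹ g t₂) a⁻¹
    have hprod : s⁻¹ * g * t = s₂⁻¹ * g * t₂ := by
      have e1 : a * s⁻¹ * z * g * (g⁻¹ * z⁻¹ * g * (t * a⁻¹)) = a * (s⁻¹ * g * t) * a⁻¹ := by group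
      have e2 : a * s₂⁻¹ * z₂ * g * (g⁻¹ * z₂⁻¹ * g * (t₂ * a⁻¹)) = a * (s₂⁻¹ * g * t₂) * a⁻¹ := by group
      have e3 : a * (s⁻¹ * g * t) * a⁻¹ = a * (s₂⁻¹ * g * t₂) * a⁻¹ := by rw [← e1, ← e2, h1, h2]
      have e4 := congrArg (fun x => a⁻¹ * x * a) e3
      simpa [mul_assoc] using e4
    obtain ⟨rfl, rfl⟩ := inv_mul_mul_injective_of_pair hpair hp.1 hp.2.1 hp₂.1 hp₂.2.1 hprod
    have hz : z = z₂ := mul_left_cancel h1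
    subst hz
    rfl
  have key := Finset.card_le_card_of_injOn Φ hmaps hinj
  simpa [Finset.card_product, mul_assoc] using key

end Summit.MatrixMultiplication.MatrixMultiplication.Theorems.ThresholdSubsetTriples
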